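import Literature.MathematicalPhysics.QuantumFieldTheory.Balaban1983to89.B9SupplySockB9P3ZdInstance

/-!
# `Balaban1983to89.B9Eq336RegularityClassesOrbit` — [Balaban1985BackgroundPropagators] (3.35)–(3.36) p. 396: THE REGULARITY CLASSES ARE ORBIT STATEMENTS — the
# class (3.35) and the class (3.35)–(3.36) of a background `U` are invariant under `U ↦ U^w` for every gauge function `w` of norm `≤ 1` with inverse of norm `≤ 1`
# (the witness gauge of `U^w` on a cube is `u_□·w⁻¹`), at the abstract carrier of [B9] Sect. A (r06's `Reg335Cube` ∕ `Reg336Cube` ∕ `Reg335` ∕ `Reg336`) and,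
# for (3.36), at the junction's `ℤᵈ` frame `bgZd` — the (3.36) twin of n16-b's `reg335Zd_gaugeAct` ∕ `B9SupplySockB9P3ZdInstance.reg335_bgZd_gaugeAct`

statement-level skeleton of published theorems with citation tags; proofs where landed; nothing here is a claim about the
Yang–Mills mass gap

T. Bałaban, *Propagators for lattice gauge theories in a background field*, Commun. Math. Phys. **99** (1985) 389–434 [`Balaban1985BackgroundPropagators`,
"B9"], journal page = PDF page + 388.  THE PRINT (verbatim, p. 396): *«for an arbitrary cube □ of the described above class, and for a configuration U there
exists a gauge transformation u on □ such that U^u = e^{iηA}, and if the index of □ is j, then |A| < O(1)Mα₀(Lʲη)⁻¹, |∂^ηA| < O(1)Mα₀(Lʲη)⁻² on □ (3.35);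
|∂^{η*}∂^ηA| < O(1)Mα₀(Lʲη)⁻³ on □ (3.36)»*; p. 398: *«All these inequalities are invariant with respect to gauge transformations of U»*; (3.28) p. 395
(the gauge action `U^u`).

CITATION HEADER ∕ WHY THIS FILE (cell `pub-ymgap`, HUMAN RULING D-0062 ∕ D-0149; width seat `pub-ymgap-dag-n06-w3` (g3), node N06 = [B9]; CLAIM-5, the
(3.35)–(3.36) rung of this seat's (iii) package «(3.28)–(3.36) are orbit statements at the carrier»).  The (3.35) class at `ℤᵈ` is known to be gauge invariant
(`B9Eq335AxialCriterion.reg335Zd_gaugeAct`, `B9SupplySockB9P3ZdInstance.reg335_bgZd_gaugeAct`); this file gives the same at the ABSTRACT carrier (any lattice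
`S`, translations `T`), for BOTH printed classes, with the two-sided `iff`, and the (3.36) field of the frame `bgZd`.  MECHANISM: the composition law
`(U^w)^{u} = U^{u·w}` (`gaugeTr_gaugeTr`), so the cube witness `(u, A)` of `U` yields the witness `(u·w⁻¹, A)` of `U^w` — same `A`, hence the same three ∕ four
inequalities; the norm clause `‖u·w⁻¹‖, ‖(u·w⁻¹)⁻¹‖ ≤ 1` on the cube by submultiplicativity.

WHAT IS PROVED (kernel, 0 sorry, 0 def; no `instance`, no `notation`).
* §1 `gaugeTr_gaugeTr` (`(U^w)^u = U^{uw}`), `gaugeTr_inv_gaugeTr` (`(U^w)^{w⁻¹} = U`).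
* §2 ★ `reg335Cube_gaugeTr` ∕ ★ `reg336Cube_gaugeTr` (one cube; `w` normed on the cube only), ★★ `reg335_gaugeTr_iff` ∕ ★★ `reg336_gaugeTr_iff` (the classes; `w`
  normed everywhere).
* §3 at the frame: ★★ `reg336_bgZd_gaugeAct` ∕ `reg336_bgZd_gaugeAct_iff'` — the (3.36) field `(bgZd 𝔸 L x).Reg336 c α₀` passes `U ↦ U^v` (unitary `v`) and back;
  `reg335_bgZd_gaugeAct_iff'` — the two-sided form of the Instance's (3.35) lemma.

HONEST SCOPE.  Bookkeeping of (3.28) on the printed classes; no estimate of [B9]; count-neutral; N05 ∕ N06 NOT discharged; K1⁷ `stmt-QuantumFields-20542` NOT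
closed; one finite `𝕋⁴` programme at fixed `ε`, Bałaban as printed; R4 closes only the conditional finite-`𝕋⁴` rung `BalabanLadder.UV` — nothing continuum ∕
ℝ⁴ ∕ OS ∕ mass gap ∕ Clay.  Unit `pub-ymgap-dag-n06-w3` (g3), 2026-08-28.
-/

noncomputable section

namespace Literature.MathematicalPhysics.QuantumFieldTheory.Balaban1983to89.B9Eq336RegularityClassesOrbit

open B7Prop1Explicit (gaugeAct U1 e mem_U1)
open B7Prop2Explicit (unitaryUnits unitaryUnits_le_U1)
open B8Eq133Hypotheses (shiftT byDir gaugeTr_byDir)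
open B9Eq3117Current (gaugeTr)
open B9Eq335RegularityClasses (Reg335Cube Reg336Cube Reg335 Reg336)
open B9SupplySockB9P3ZdFrame (MemberZd CfgZd bgZd reg335_bgZd_iff reg336_bgZd_iff)
open B9SupplySockB9P3ZdInstance (gaugeAct_mem_unitaryUnits reg335_bgZd_gaugeAct)
open LatticeNorms (scaleLen)

-- `Site` alone could resolve to the torus sites of `Setup.lean`; re-export the `ℤ^d` sites of `B7Prop1Explicit`.
export B7Prop1Explicit (Site)

/-! ## §1  The composition law of the gauge action at the abstract carrier -/

section Composition

variable {𝔸 : Type*} [Ring 𝔸] {S : Type*} {ι : Type*} (T : ι → Equiv.Perm S) (U : ι → S → 𝔸ˣ)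

/-- **`(U^w)^u = U^{u·w}`** (pointwise product of gauge functions). [folklore] [cite: Balaban1985BackgroundPropagators, (3.28) p.395] -/
theorem gaugeTr_gaugeTr (u w : S → 𝔸ˣ) : gaugeTr T u (gaugeTr T w U) = gaugeTr T (u * w) U := by
  funext μ x
  simp only [gaugeTr, Pi.mul_apply, mul_inv_rev, mul_assoc]

/-- **`(U^w)^{w⁻¹} = U`**. [folklore] [cite: Balaban1985BackgroundPropagators, (3.28) p.395] -/
theorem gaugeTr_inv_gaugeTr (w : S → 𝔸ˣ) : gaugeTr T w⁻¹ (gaugeTr T w U) = U := by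
  rw [gaugeTr_gaugeTr, inv_mul_cancel]
  funext μ x
  simp [gaugeTr]

end Composition

/-! ## §2  The classes (3.35) and (3.35)–(3.36) are invariant under `U ↦ U^w` -/

section Classes

variable {𝔸 : Type*} [NormedRing 𝔸] [NormedAlgebra ℂ 𝔸] [CompleteSpace 𝔸] {S : Type*} {ι : Type*} [Fintype ι] [LinearOrder ι]
  (T : ι → Equiv.Perm S) {U : ι → S → 𝔸ˣ}

omit [NormedAlgebra ℂ 𝔸] [CompleteSpace 𝔸] in
/-- the norm clause of the witness `u·w⁻¹`: `‖u(z)w(z)⁻¹‖ ≤ 1` and `‖(u(z)w(z)⁻¹)⁻¹‖ = ‖w(z)u(z)⁻¹‖ ≤ 1`. [folklore]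
[cite: Balaban1985BackgroundPropagators, (3.35) p.396 (bookkeeping)] -/
private theorem norm_clause {u w : S → 𝔸ˣ} {z : S} (hu : ‖(u z : 𝔸)‖ ≤ 1 ∧ ‖(((u z)⁻¹ : 𝔸ˣ) : 𝔸)‖ ≤ 1)
    (hw : ‖(w z : 𝔸)‖ ≤ 1 ∧ ‖(((w z)⁻¹ : 𝔸ˣ) : 𝔸)‖ ≤ 1) :
    ‖((u * w⁻¹) z : 𝔸)‖ ≤ 1 ∧ ‖((((u * w⁻¹) z)⁻¹ : 𝔸ˣ) : 𝔸)‖ ≤ 1 := by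
  rw [Pi.mul_apply, Pi.inv_apply, mul_inv_rev, inv_inv, Units.val_mul, Units.val_mul]
  exact ⟨(norm_mul_le _ _).trans (mul_le_one₀ hu.1 (norm_nonneg _) hw.2),
    (norm_mul_le _ _).trans (mul_le_one₀ hw.1 (norm_nonneg _) hu.2)⟩

omit [Fintype ι] [LinearOrder ι] in
/-- ★ **(3.35) ON A CUBE PASSES TO `U^w`** for `w` with `‖w‖, ‖w⁻¹‖ ≤ 1` on the cube: the witness `(u, A)` of `U` gives the witness `(u·w⁻¹, A)` of `U^w`.
[cite: Balaban1985BackgroundPropagators, (3.35) p.396, (3.28) p.395, p.398 («invariant with respect to gauge transformations of U»)] -/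
theorem reg335Cube_gaugeTr {η : ℝ} {cube : Set S} {ξ C : ℝ} {w : S → 𝔸ˣ}
    (hw : ∀ z ∈ cube, ‖(w z : 𝔸)‖ ≤ 1 ∧ ‖(((w z)⁻¹ : 𝔸ˣ) : 𝔸)‖ ≤ 1) (h : Reg335Cube T U η cube ξ C) :
    Reg335Cube T (gaugeTr T w U) η cube ξ C := by
  obtain ⟨u, A, hu, hg, hA, hD⟩ := h
  refine ⟨u * w⁻¹, A, fun z hz => norm_clause (hu z hz) (hw z hz), fun κ z hz => ?_, hA, hD⟩
  rw [gaugeTr_gaugeTr, mul_assoc, inv_mul_cancel, mul_one]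
  exact hg κ z hz

/-- ★ **(3.35)–(3.36) ON A CUBE PASSES TO `U^w`** (same witness, same `A`). [cite: Balaban1985BackgroundPropagators, (3.35)–(3.36) p.396, (3.28) p.395, p.398] -/
theorem reg336Cube_gaugeTr {η : ℝ} {cube : Set S} {ξ C : ℝ} {w : S → 𝔸ˣ}
    (hw : ∀ z ∈ cube, ‖(w z : 𝔸)‖ ≤ 1 ∧ ‖(((w z)⁻¹ : 𝔸ˣ) : 𝔸)‖ ≤ 1) (h : Reg336Cube T U η cube ξ C) :
    Reg336Cube T (gaugeTr T w U) η cube ξ C := by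
  obtain ⟨u, A, hu, hg, hA, hD, hDD⟩ := h
  refine ⟨u * w⁻¹, A, fun z hz => norm_clause (hu z hz) (hw z hz), fun κ z hz => ?_, hA, hD, hDD⟩
  rw [gaugeTr_gaugeTr, mul_assoc, inv_mul_cancel, mul_one]
  exact hg κ z hz

variable {w : S → 𝔸ˣ} (hw : ∀ z, ‖(w z : 𝔸)‖ ≤ 1 ∧ ‖(((w z)⁻¹ : 𝔸ˣ) : 𝔸)‖ ≤ 1)
include hw

omit [NormedAlgebra ℂ 𝔸] [CompleteSpace 𝔸] in
/-- the same clause for `w⁻¹`. [folklore] [cite: Balaban1985BackgroundPropagators, (3.28) p.395 (bookkeeping)] -/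
private theorem hw_inv : ∀ z, ‖(w⁻¹ z : 𝔸)‖ ≤ 1 ∧ ‖(((w⁻¹ z)⁻¹ : 𝔸ˣ) : 𝔸)‖ ≤ 1 := fun z => by
  rw [Pi.inv_apply, inv_inv]
  exact ⟨(hw z).2, (hw z).1⟩

omit [Fintype ι] [LinearOrder ι] in
/-- ★★ **THE CLASS (3.35) IS AN ORBIT STATEMENT** at the abstract carrier: `U^w` is in the class iff `U` is (`w` with `‖w‖, ‖w⁻¹‖ ≤ 1` everywhere — e.g. unitary
values in a C⋆-algebra). [cite: Balaban1985BackgroundPropagators, (3.35) p.396, (3.28) p.395, p.398] -/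
theorem reg335_gaugeTr_iff {η L : ℝ} {𝒬 : Set (Set S × ℕ)} {C : ℝ} : Reg335 T (gaugeTr T w U) η L 𝒬 C ↔ Reg335 T U η L 𝒬 C := by
  constructor
  · intro h q hq
    have h1 := reg335Cube_gaugeTr T (U := gaugeTr T w U) (fun z _ => hw_inv hw z) (h q hq)
    rwa [gaugeTr_inv_gaugeTr] at h1
  · exact fun h q hq => reg335Cube_gaugeTr T (fun z _ => hw z) (h q hq)

/-- ★★ **THE CLASS (3.35)–(3.36) IS AN ORBIT STATEMENT** at the abstract carrier. [cite: Balaban1985BackgroundPropagators, (3.35)–(3.36) p.396, (3.28) p.395, p.398] -/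
theorem reg336_gaugeTr_iff {η L : ℝ} {𝒬 : Set (Set S × ℕ)} {C : ℝ} : Reg336 T (gaugeTr T w U) η L 𝒬 C ↔ Reg336 T U η L 𝒬 C := by
  constructor
  · intro h q hq
    have h1 := reg336Cube_gaugeTr T (U := gaugeTr T w U) (fun z _ => hw_inv hw z) (h q hq)
    rwa [gaugeTr_inv_gaugeTr] at h1
  · exact fun h q hq => reg336Cube_gaugeTr T (fun z _ => hw z) (h q hq)

end Classes

/-! ## §3  At the junction's `ℤᵈ` frame: the (3.36) field of `bgZd` (and the two-sided (3.35) form) -/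

section Frame

variable {d : ℕ} {𝔸 : Type} [CStarAlgebra 𝔸] [Nontrivial 𝔸] {L : ℕ}

/-- unitary gauge functions satisfy the norm clause. [cite: Balaban1985RegularSpaces, (1.15)–(1.17) p.78 (bookkeeping)] -/
private theorem hw_of_unitary {v : Site d → 𝔸ˣ} (hv : ∀ x, v x ∈ unitaryUnits 𝔸) :
    ∀ z, ‖(v z : 𝔸)‖ ≤ 1 ∧ ‖(((v z)⁻¹ : 𝔸ˣ) : 𝔸)‖ ≤ 1 := fun z => mem_U1.1 (unitaryUnits_le_U1 (hv z))

/-- ★★ **THE (3.36) FIELD OF THE FRAME IS GAUGE INVARIANT**: `(bgZd 𝔸 L x).Reg336 c α₀ U` ⟹ the same at `U^v` for unitary `v` (the (3.36) twin of the Instance's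
`reg335_bgZd_gaugeAct`). [cite: Balaban1985BackgroundPropagators, (3.35)–(3.36) p.396, (3.28) p.395, p.398] -/
theorem reg336_bgZd_gaugeAct (x : MemberZd d L) {c α₀ : ℝ} {U : CfgZd d 𝔸} (h : (bgZd 𝔸 L x).Reg336 c α₀ U)
    (v : Site d → 𝔸ˣ) (hv : ∀ x, v x ∈ unitaryUnits 𝔸) :
    (bgZd 𝔸 L x).Reg336 c α₀ (⟨gaugeAct v U.1, gaugeAct_mem_unitaryUnits U.2 hv⟩ : CfgZd d 𝔸) := by
  rw [reg336_bgZd_iff] at h ⊢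
  dsimp only
  rw [← gaugeTr_byDir]
  exact (reg336_gaugeTr_iff (shiftT d) (hw_of_unitary hv)).2 h

/-- ★ **… AND BACK**: `U^v` in the (3.36) class ⟹ `U` in it. [cite: Balaban1985BackgroundPropagators, (3.35)–(3.36) p.396, (3.28) p.395] -/
theorem reg336_bgZd_of_gaugeAct (x : MemberZd d L) {c α₀ : ℝ} {U : CfgZd d 𝔸} (v : Site d → 𝔸ˣ) (hv : ∀ x, v x ∈ unitaryUnits 𝔸)
    (h : (bgZd 𝔸 L x).Reg336 c α₀ (⟨gaugeAct v U.1, gaugeAct_mem_unitaryUnits U.2 hv⟩ : CfgZd d 𝔸)) :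
    (bgZd 𝔸 L x).Reg336 c α₀ U := by
  rw [reg336_bgZd_iff] at h ⊢
  dsimp only at h
  rw [← gaugeTr_byDir] at h
  exact (reg336_gaugeTr_iff (shiftT d) (hw_of_unitary hv)).1 h

/-- ★ **THE TWO-SIDED (3.35) FORM AT THE FRAME**: `U^v` in the class ⟹ `U` in it (the converse of the Instance's `reg335_bgZd_gaugeAct`).
[cite: Balaban1985BackgroundPropagators, (3.35) p.396, (3.28) p.395] -/
theorem reg335_bgZd_of_gaugeAct (x : MemberZd d L) {c α₀ : ℝ} {U : CfgZd d 𝔸} (v : Site d → 𝔸ˣ) (hv : ∀ x, v x ∈ unitaryUnits 𝔸)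
    (h : (bgZd 𝔸 L x).Reg335 c α₀ (⟨gaugeAct v U.1, gaugeAct_mem_unitaryUnits U.2 hv⟩ : CfgZd d 𝔸)) :
    (bgZd 𝔸 L x).Reg335 c α₀ U := by
  rw [reg335_bgZd_iff] at h ⊢
  dsimp only at h
  unfold B8Eq133Hypotheses.Reg335Zd at h ⊢
  rw [← gaugeTr_byDir] at h
  exact (reg335_gaugeTr_iff (shiftT d) (hw_of_unitary hv)).1 h

end Frame

end Literature.MathematicalPhysics.QuantumFieldTheory.Balaban1983to89.B9Eq336RegularityClassesOrbit

end
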